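import Summits.PneNP.PneNP.Theses.OneSlice
import Summits.PneNP.PneNP.Theorems.SingleThreshold.Negative.LoadBearing
import Literature.Computability.Complexity.RossmanMonotoneCliqueThm2Proofs
import Literature.Computability.Complexity.GnpSprinkling

/-!
# Negative lemmas on the stub set of line `two-round-exposure` (crux `SingleThreshold`, stmt-PneNP-2833)

Drefute seat `refuter-drefute-stmt-PneNP-2833-0`, skeleton sha `860338436184…` (lead
`prover-line-stmt-PneNP-2833-0`, 2026-08-16). Load-bearing analysis of the ACTIVE stubs, kernel-checked:

* `cliqueMinusEdgeInvisible_false_without_epsBound` — stub `stub_cliqueMinusEdgeInvisible` with its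
  hypothesis `ε ≤ 1/k³` DROPPED is FALSE: at `k = 5`, `ε = 3` the sprinkle density is
  `pMinus 5 3 n = n⁻²`, the sprinkle `S` is EMPTY with probability `≥ 1/2`, and the monotone test
  "`x` has an edge" is flipped by every planted `K_A - e`; so the planted-proper-pattern event has
  probability `≥ 1/2 > n^{-c₁}`. (On paper the exact range of the stub is `ε < 2/(k²-k-2)`, the
  strict 1-balancedness threshold of `K_k⁻` at density `n^{-2(1+ε)/(k-1)}`: above it the planted
  `K_k⁻` itself is a.a.s. absent from `S` and the test "contains a `K_k⁻`" has advantage `→ 1`;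
  `ε ≤ k⁻³` is safely inside. Any proof of the stub must therefore use the upper bound on `ε`.)
-/

namespace Summit.PneNP.PneNP.Theorems.SingleThreshold.Negative.TwoRoundExposure

set_option linter.dupNamespace false

open Literature.Computability.Complexity Finset Filter Classical
open Summit.PneNP.PneNP.Theorems.SingleThreshold.Negative (Edges)

noncomputable section

/-- `pMinus 5 3 n = n⁻²`. [folklore] -/
theorem pMinus_five_three (n : ℕ) : pMinus 5 3 n = ((n : ℝ) ^ 2)⁻¹ := by
  rw [pMinus, show (-(2 * (1 + (3 : ℝ))) / (((5 : ℕ) : ℝ) - 1)) = -((2 : ℕ) : ℝ) by norm_num,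
    Real.rpow_neg (Nat.cast_nonneg n), Real.rpow_natCast]

/-- The weight of the empty graph is `(1 - q)^{C(n,2)}`. [folklore] -/
theorem gnpWeight_bot (n : ℕ) (q : ℝ) :
    gnpWeight n q (⊥ : Edges n → Bool) = (1 - q) ^ (n.choose 2) := by
  have h0 : edgeCount (⊥ : Edges n → Bool) = 0 := by
    unfold edgeCount
    simp
  simp [gnpWeight, h0]

/-- Bernoulli at the empty graph: `(1 - n⁻²)^{C(n,2)} ≥ 1/2`. [folklore] -/
theorem half_le_gnpWeight_bot (n : ℕ) (hn : 1 ≤ n) :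
    (1 : ℝ) / 2 ≤ gnpWeight n (((n : ℝ) ^ 2)⁻¹) (⊥ : Edges n → Bool) := by
  rw [gnpWeight_bot]
  have hn1 : (1 : ℝ) ≤ n := by exact_mod_cast hn
  have hq1 : ((n : ℝ) ^ 2)⁻¹ ≤ 1 := inv_le_one_of_one_le₀ (by nlinarith)
  have hbern : 1 + (n.choose 2 : ℕ) * (-((n : ℝ) ^ 2)⁻¹) ≤ (1 + -((n : ℝ) ^ 2)⁻¹) ^ (n.choose 2) :=
    one_add_mul_le_pow (by linarith) _
  have hchoose : ((n.choose 2 : ℕ) : ℝ) ≤ (n : ℝ) ^ 2 / 2 := by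
    rw [Nat.cast_choose_two]
    nlinarith
  have hmul : ((n.choose 2 : ℕ) : ℝ) * ((n : ℝ) ^ 2)⁻¹ ≤ 1 / 2 := by
    rw [← div_eq_mul_inv, div_le_iff₀ (by positivity)]
    linarith
  calc (1 : ℝ) / 2 ≤ 1 + (n.choose 2 : ℕ) * (-((n : ℝ) ^ 2)⁻¹) := by rw [mul_neg]; linarith
    _ ≤ (1 + -((n : ℝ) ^ 2)⁻¹) ^ (n.choose 2) := hbern
    _ = (1 - ((n : ℝ) ^ 2)⁻¹) ^ (n.choose 2) := by rw [← sub_eq_add_neg]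

/-- **`stub_cliqueMinusEdgeInvisible` is false without its upper bound on `ε`.** With `ε ≤ 1/k³`
dropped, the witness `k = 5`, `ε = 3` (`q = n⁻²`), `f = [x ≠ ∅]` (monotone) has
`Pr_{S,A}[f(S) = 0 ∧ ∃ e ∈ K_A, f(S ∪ (K_A - e)) = 1] ≥ Pr[S = ∅] ≥ 1/2`, which is not `≤ n^{-c₁}`
for any `c₁ > 0`. [folklore] -/
theorem cliqueMinusEdgeInvisible_false_without_epsBound :
    ¬ ∀ k : ℕ, 5 ≤ k → ∀ ε : ℝ, 0 < ε → ∃ c₁ : ℝ, 0 < c₁ ∧ ∀ᶠ n : ℕ in atTop,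
      ∀ f : (Edges n → Bool) → Bool, Monotone f →
        (∑ x : Edges n → Bool, gnpWeight n (pMinus k ε n) x *
          kSubsetProb n k (fun A => f x = false ∧ ∃ e, cliqueVec A e = true ∧
            f (x ⊔ Function.update (cliqueVec A) e false) = true)) ≤ (n : ℝ) ^ (-c₁) := by
  intro h
  obtain ⟨c₁, hc₁, hev⟩ := h 5 le_rfl 3 (by norm_num)
  have hsmall : ∀ᶠ n : ℕ in atTop, (n : ℝ) ^ (-c₁) < 1 / 2 := by
    have ht : Tendsto (fun n : ℕ => (n : ℝ) ^ (-c₁)) atTop (nhds 0) :=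
      (tendsto_rpow_neg_atTop hc₁).comp tendsto_natCast_atTop_atTop
    exact ht.eventually_lt_const (by norm_num)
  obtain ⟨n, hn, hlt, hn5⟩ := (hev.and (hsmall.and (eventually_ge_atTop 5))).exists
  -- the monotone test "x has an edge"
  set f : (Edges n → Bool) → Bool := fun x => decide (x ≠ ⊥) with hf
  have hfm : Monotone f := by
    intro x y hxy
    simp only [hf]
    rw [Bool.le_iff_imp]
    simp only [ne_eq, decide_eq_true_eq]
    intro hx hy
    subst hy
    exact hx (le_bot_iff.1 hxy)
  have key := hn f hfm
  rw [pMinus_five_three] at key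
  have hn1 : 1 ≤ n := by omega
  have hn0 : (0 : ℝ) < n := by exact_mod_cast hn1
  have hq0 : 0 ≤ ((n : ℝ) ^ 2)⁻¹ := by positivity
  have hq1 : ((n : ℝ) ^ 2)⁻¹ ≤ 1 := by
    apply inv_le_one_of_one_le₀
    have : (1 : ℝ) ≤ n := by exact_mod_cast hn1
    nlinarith
  -- every term is nonnegative, so the sum is at least its `x = ⊥` term
  have hterm : ∀ x : Edges n → Bool, 0 ≤ gnpWeight n (((n : ℝ) ^ 2)⁻¹) x *
      kSubsetProb n 5 (fun A => f x = false ∧ ∃ e, cliqueVec A e = true ∧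
        f (x ⊔ Function.update (cliqueVec A) e false) = true) := fun x =>
    mul_nonneg (gnpWeight_nonneg hq0 hq1 x) (kSubsetProb_nonneg _ _ _)
  have hbot : gnpWeight n (((n : ℝ) ^ 2)⁻¹) ⊥ *
      kSubsetProb n 5 (fun A => f ⊥ = false ∧ ∃ e, cliqueVec A e = true ∧
        f (⊥ ⊔ Function.update (cliqueVec A) e false) = true) ≤
      ∑ x : Edges n → Bool, gnpWeight n (((n : ℝ) ^ 2)⁻¹) x *
        kSubsetProb n 5 (fun A => f x = false ∧ ∃ e, cliqueVec A e = true ∧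
          f (x ⊔ Function.update (cliqueVec A) e false) = true) :=
    Finset.single_le_sum (f := fun x => gnpWeight n (((n : ℝ) ^ 2)⁻¹) x *
      kSubsetProb n 5 (fun A => f x = false ∧ ∃ e, cliqueVec A e = true ∧
        f (x ⊔ Function.update (cliqueVec A) e false) = true)) (fun x _ => hterm x) (mem_univ _)
  -- the event holds for EVERY 5-set `A` at `x = ⊥`
  have hP : kSubsetProb n 5 (fun A => f ⊥ = false ∧ ∃ e, cliqueVec A e = true ∧
        f (⊥ ⊔ Function.update (cliqueVec A) e false) = true) = 1 := by
    unfold kSubsetProb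
    rw [Finset.filter_true_of_mem, card_powersetCard, card_univ, Fintype.card_fin,
      div_self (by exact_mod_cast (Nat.choose_pos hn5).ne')]
    intro A hA
    have hA5 : #A = 5 := (mem_powersetCard.1 hA).2
    refine ⟨by simp [hf], ?_⟩
    obtain ⟨a, ha, b, hb, c, hc, hab, hac, hbc⟩ := Finset.two_lt_card.1 (by omega : 2 < #A)
    have heab : s(a, b) ∈ (⊤ : SimpleGraph (Fin n)).edgeSet := by
      rw [SimpleGraph.mem_edgeSet, SimpleGraph.top_adj]; exact hab
    have heac : s(a, c) ∈ (⊤ : SimpleGraph (Fin n)).edgeSet := by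
      rw [SimpleGraph.mem_edgeSet, SimpleGraph.top_adj]; exact hac
    have hne : (⟨s(a, c), heac⟩ : Edges n) ≠ ⟨s(a, b), heab⟩ := by
      intro hh
      have h2 := congrArg Subtype.val hh
      simp only [Sym2.eq_iff] at h2
      rcases h2 with ⟨-, hcb⟩ | ⟨hab', -⟩
      · exact hbc hcb.symm
      · exact hab hab'
    refine ⟨⟨s(a, b), heab⟩, by simp [cliqueVec, ha, hb], ?_⟩
    simp only [hf, ne_eq, decide_eq_true_eq, bot_sup_eq]
    intro hh
    have h3 := congrFun hh ⟨s(a, c), heac⟩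
    rw [Function.update_of_ne hne] at h3
    simp [cliqueVec, ha, hc] at h3
  rw [hP, mul_one] at hbot
  have h12 := half_le_gnpWeight_bot n hn1
  linarith

/-! ## S5 `stub_descentSplit`: the descent-split event is contained in the output flip -/

/-- **The needle's event is a sub-event of the output flip.** If the exact-clique descent-split event of
`stub_descentSplit` holds at `(x, A)` with `#A = k ≥ 2`, then the approximated output FLIPS under planting:
`ap out (x ∪ K_A) = 1` and `ap out x = 0` (the clause `i = 0` makes `K_A ≠ ⊥` a minterm of
`y ↦ ap out (x ⊔ y)`). Consequently `Pr[DescentSplit] ≤ adv_q(ap out)`, so the stub follows from — and can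
only be refuted together with — indistinguishability of `S ∪ K_A` from `S` for the approximators of
size-`n^c` programs (`∀ k ≥ k₀ ∀ ε ≤ ε₀` form). [folklore] -/
theorem descentSplit_subset_flip {n k : ℕ} (hk : 2 ≤ k) (gs : List (Gate (Edges n)))
    (out : Edges n ⊕ ℕ) (ap : Edges n ⊕ ℕ → (Edges n → Bool) → Bool)
    (x : Edges n → Bool) (A : Finset (Fin n)) (hA : #A = k)
    (h : ∃ (r m : ℕ) (u v : Edges n ⊕ ℕ) (w : ℕ → Edges n ⊕ ℕ), w 0 = out ∧ w r = Sum.inr m ∧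
      gs[m]? = some (GateList.andGate u v) ∧
      (∀ i, i < r → ∃ (m' : ℕ) (u' v' : Edges n ⊕ ℕ), w i = Sum.inr m' ∧
        (gs[m']? = some (GateList.andGate u' v') ∨ gs[m']? = some (GateList.orGate u' v')) ∧
        (w (i + 1) = u' ∨ w (i + 1) = v')) ∧
      (∀ i, i ≤ r → IsMinterm (fun y => ap (w i) (x ⊔ y)) (cliqueVec A)) ∧
      ¬ IsMinterm (fun y => ap u (x ⊔ y)) (cliqueVec A) ∧
      ¬ IsMinterm (fun y => ap v (x ⊔ y)) (cliqueVec A)) :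
    ap out (x ⊔ cliqueVec A) = true ∧ ap out x = false := by
  obtain ⟨r, m, u, v, w, hw0, -, -, -, hmin, -, -⟩ := h
  have h0 := hmin 0 (Nat.zero_le r)
  rw [hw0] at h0
  refine ⟨h0.1, ?_⟩
  have hbot : (⊥ : Edges n → Bool) < cliqueVec A := by
    rw [bot_lt_iff_ne_bot]
    obtain ⟨a, ha, b, hb, hab⟩ := Finset.one_lt_card.1 (by omega : 1 < #A)
    intro hh
    have heab : s(a, b) ∈ (⊤ : SimpleGraph (Fin n)).edgeSet := by
      rw [SimpleGraph.mem_edgeSet, SimpleGraph.top_adj]; exact hab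
    have h1 := congrFun hh ⟨s(a, b), heab⟩
    simp [cliqueVec, ha, hb] at h1
  have h2 := h0.2 ⊥ hbot
  simpa using h2

/-- **Probability form**: for any density `q ∈ [0,1]` and `k ≥ 2`, the `(S, A)`-probability of the
descent-split event of `stub_descentSplit` is at most the flip probability
`Pr_{S,A}[ap out (S ∪ K_A) = 1 ∧ ap out (S) = 0]` (`= E ap_out(S ∪ K_A) − E ap_out(S)` for monotone
`ap out`). [folklore] -/
theorem descentSplitProb_le_flipProb {n k : ℕ} (hk : 2 ≤ k) {q : ℝ} (hq0 : 0 ≤ q) (hq1 : q ≤ 1)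
    (gs : List (Gate (Edges n))) (out : Edges n ⊕ ℕ) (ap : Edges n ⊕ ℕ → (Edges n → Bool) → Bool) :
    (∑ x : Edges n → Bool, gnpWeight n q x * kSubsetProb n k (fun A =>
        ∃ (r m : ℕ) (u v : Edges n ⊕ ℕ) (w : ℕ → Edges n ⊕ ℕ), w 0 = out ∧ w r = Sum.inr m ∧
          gs[m]? = some (GateList.andGate u v) ∧
          (∀ i, i < r → ∃ (m' : ℕ) (u' v' : Edges n ⊕ ℕ), w i = Sum.inr m' ∧
            (gs[m']? = some (GateList.andGate u' v') ∨ gs[m']? = some (GateList.orGate u' v')) ∧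
            (w (i + 1) = u' ∨ w (i + 1) = v')) ∧
          (∀ i, i ≤ r → IsMinterm (fun y => ap (w i) (x ⊔ y)) (cliqueVec A)) ∧
          ¬ IsMinterm (fun y => ap u (x ⊔ y)) (cliqueVec A) ∧
          ¬ IsMinterm (fun y => ap v (x ⊔ y)) (cliqueVec A))) ≤
      ∑ x : Edges n → Bool, gnpWeight n q x *
        kSubsetProb n k (fun A => ap out (x ⊔ cliqueVec A) = true ∧ ap out x = false) := by
  refine sum_le_sum fun x _ => mul_le_mul_of_nonneg_left ?_ (gnpWeight_nonneg hq0 hq1 x)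
  unfold kSubsetProb
  refine div_le_div_of_nonneg_right ?_ (Nat.cast_nonneg _)
  exact_mod_cast card_le_card (fun A hA => by
    rw [mem_filter] at hA ⊢
    exact ⟨hA.1, descentSplit_subset_flip hk gs out ap x A (mem_powersetCard.1 hA.1).2 hA.2⟩)

/-! ## S4 `stub_exactCliqueDescent` is sharp in `k`: false at `k = 2` -/

/-- `K_2` has one edge. [folklore] -/
theorem edges_two_eq (e : Edges 2) : e = Negative.e01 2 le_rfl := by
  obtain ⟨e, he⟩ := e
  apply Subtype.ext
  induction e using Sym2.ind with
  | h a b =>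
    have hab : a ≠ b := by simpa using he
    change s(a, b) = s((⟨0, by omega⟩ : Fin 2), ⟨1, by omega⟩)
    rw [Sym2.eq_iff]
    fin_cases a <;> fin_cases b <;> simp_all

/-- **`stub_exactCliqueDescent` with `3 ≤ k` weakened to `k = 2` is FALSE** (small model `n = 2`): for the
EMPTY program and the output wire = the input `x_e` of the unique edge `e` of `K_2`, at `x = ⊥` the exact
clique `K_{{0,1}} = 1_{e}` IS a minterm of `y ↦ (⊥ ⊔ y)_e`, but there is no `∧`-gate to descend to. So the
hypothesis `3 ≤ k` (which makes `K_A` have ≥ 3 edges, hence never an input minterm) is load-bearing.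
[folklore] -/
theorem exactCliqueDescent_false_at_two :
    ¬ ∀ (n : ℕ) (p t : ℝ) (gs : List (Gate (Edges n))) (ap : Edges n ⊕ ℕ → (Edges n → Bool) → Bool),
      GateList.WF gs → (∀ g ∈ gs, g.fn ∈ monotoneBasis) → (∀ i, ap (Sum.inl i) = fun x => x i) →
      (∀ (m : ℕ) (u v : Edges n ⊕ ℕ), gs[m]? = some (GateList.andGate u v) →
        ap (Sum.inr m) = fun x => ap u x && ap v x) →
      (∀ (m : ℕ) (u v : Edges n ⊕ ℕ), gs[m]? = some (GateList.orGate u v) →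
        ap (Sum.inr m) = starClosure p t (smallI n 2 ∪ medJ n 2) (fun x => ap u x || ap v x)) →
      (∀ w, GateList.OutOK gs.length w → Monotone (ap w)) →
      ∀ (x : Edges n → Bool) (A : Finset (Fin n)), #A = 2 → ∀ out : Edges n ⊕ ℕ,
        GateList.OutOK gs.length out → IsMinterm (fun y => ap out (x ⊔ y)) (cliqueVec A) →
        ∃ (r m : ℕ) (u v : Edges n ⊕ ℕ) (w : ℕ → Edges n ⊕ ℕ), w 0 = out ∧ w r = Sum.inr m ∧
          gs[m]? = some (GateList.andGate u v) ∧
          (∀ i, i < r → ∃ (m' : ℕ) (u' v' : Edges n ⊕ ℕ), w i = Sum.inr m' ∧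
            (gs[m']? = some (GateList.andGate u' v') ∨ gs[m']? = some (GateList.orGate u' v')) ∧
            (w (i + 1) = u' ∨ w (i + 1) = v')) ∧
          (∀ i, i ≤ r → IsMinterm (fun y => ap (w i) (x ⊔ y)) (cliqueVec A)) ∧
          ¬ IsMinterm (fun y => ap u (x ⊔ y)) (cliqueVec A) ∧
          ¬ IsMinterm (fun y => ap v (x ⊔ y)) (cliqueVec A) := by
  intro h
  set e₀ : Edges 2 := Negative.e01 2 le_rfl with he₀
  set ap : Edges 2 ⊕ ℕ → (Edges 2 → Bool) → Bool := fun w =>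
    match w with
    | .inl i => fun x => x i
    | .inr _ => fun _ => true with hap
  have hwf : GateList.WF ([] : List (Gate (Edges 2))) := fun j g hg => by simp at hg
  have htop : cliqueVec (univ : Finset (Fin 2)) = ⊤ := by
    funext e; simp [cliqueVec]
  have hmin : IsMinterm (fun y => ap (Sum.inl e₀) (⊥ ⊔ y)) (cliqueVec (univ : Finset (Fin 2))) := by
    rw [htop]
    refine ⟨by simp [hap], fun y hy => ?_⟩
    simp only [hap, bot_sup_eq]
    by_contra hye
    rw [Bool.not_eq_false] at hye
    apply hy.ne
    funext e
    rw [edges_two_eq e]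
    simpa using hye
  obtain ⟨r, m, u, v, w, -, -, hgate, -⟩ := h 2 0 0 [] ap hwf (fun g hg => by simp at hg)
    (fun i => rfl) (fun m u v hm => by simp at hm) (fun m u v hm => by simp at hm)
    (fun w hw => by
      rcases w with i | m
      · exact fun x y hxy => hxy i
      · exact absurd (hw m rfl) (by simp))
    ⊥ univ (by simp) (Sum.inl e₀) (fun m hm => by cases hm) hmin
  simp at hgate

end

end Summit.PneNP.PneNP.Theorems.SingleThreshold.Negative.TwoRoundExposure
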